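import Literature.Topology.FourManifolds.SmoothIntersectionFormsRealisationDiagonal
import Literature.Topology.FourManifolds.StabilisationIntersectionForm
import Literature.Topology.FourManifolds.CircleSurgeryConnectedSum
import Literature.Topology.FourManifolds.CircleSurgeryExistence
import Literature.Topology.FourManifolds.LatticeFormsIndefiniteEven
import Literature.Topology.FourManifolds.LatticeFormsDefinite
import Literature.Topology.FourManifolds.LatticeFormsProofs
import Literature.Topology.FourManifolds.LatticeFormsOrthoSumSignature
import Literature.Topology.FourManifolds.LatticeFormsSplitting
import Literature.Topology.FourManifolds.IntersectionFormHomotopyInvariance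
import HarnessLib

/-!
# Freedman's realisation theorem (`spc4.S05`): the forms of signature zero, proved

Second companion of `Literature/Topology/FourManifolds/SmoothIntersectionForms.lean` (statements
unchanged) on the named fact
`Literature.Topology.FourManifolds.exists_intersectionForm_equivalent` — Freedman's realisation
theorem, M. H. Freedman, F. Quinn, *Topology of 4-Manifolds* (1990), §10.1 Theorem (1)
"Existence" (p. 161): every nonsingular symmetric form on a finitely generated free `ℤ`-module
is the form of a closed oriented 1-connected 4-manifold. The sibling
`SmoothIntersectionFormsRealisationDiagonal.lean` realises the diagonalisable forms
`j⟨1⟩ ⊕ k⟨-1⟩` (hence all odd indefinite ones) by `j ℂℙ² # k (-ℂℙ²)`; this file adds the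
hyperbolic summands: **`X ↦ X # (S² × S²)` adds a hyperbolic plane `H = (0 1; 1 0)` to the
intersection form** (Freedman–Quinn 1990, §10.1, p. 161: "`S⁴` and `S² × S²` have even forms, so
are uniquely determined by their forms"; §10.2A: the form of a connected sum is the direct sum;
Kirby, *The Topology of 4-Manifolds* (1989), Ch. II §1: "`S² × S²` has form `(0 1; 1 0)`" and
Ch. X p. 55: surgery on the trivially framed trivial circle in a coordinate ball of `M₀` gives
`M₀ # S² × S²`; Gompf–Stipsicz 1999, §1.2 and §5.2), and draws the consequence that **every
symmetric unimodular form of signature zero is the intersection form of a closed smooth simply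
connected 4-manifold**: an even one is `b H` by Serre's classification (*A Course in
Arithmetic*, Ch. V §2.2 Thm. 5/6, proved in the tree as `equivalent_of_isEven_of_isIndefinite`
from the proved Thm. 3), realised by `# b (S² × S²)`; an odd one is indefinite, hence
`j⟨1⟩ ⊕ j⟨-1⟩` (sibling file). All of it is proved from the tree's honest singular-(co)homology
vocabulary; the surgery `X # (S² × S²)` is the tree's explicit construction
`CircleNbhd.Surgered` along the standard framed circle of a chart (`CircleSurgeryExistence.lean`,
`CircleSurgeryConnectedSum.lean`), so no smooth structure on `S² × S²` charted on `ℝ⁴` is needed.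

What remains of the named fact after the two companions is exactly the set of forms that need
`‖E₈‖` (Freedman–Quinn 9.3C, the disc embedding theorem): the even forms of non-zero signature
and the non-diagonalisable odd/definite forms.

## Main statements (all proved; no definition, no named fact is introduced)

* `equivalent_prod_of_addEquiv_of_equivalent` — algebra: an additive decomposition
  `Θ : A × W₂ ≅ C` with `Q (Θ x, Θ y) = Q_A (x₁, y₁) + B₂ (x₂, y₂)` and `Q_A ≅ B₁` give
  `Q ≅ B₁ ⊥ B₂` (`ℤ`-linearity of additive maps, `AddEquiv.toIntLinearEquiv`, for arbitrary
  `Module ℤ` instances — the intersection forms live on `ModuleCat` carriers).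
* `exists_addEquiv_neg_intersectionForm_of_neg` — algebra: the sign bookkeeping
  `-(−Q_A ⊥ H) ≅ Q_A ⊥ H` through `(v₀, v₁) ↦ (v₀, -v₁)` on `H` (`H ≅ -H`).
* `exists_isConnectedSum_sphereProd_intersectionForm_equivalent_prod_hyperbolicForm` —
  **`Q_{M # (S² × S²)} ≅ Q_M ⊥ H`**, existence form: every closed smooth simply connected
  `ℤ`-oriented `(M, μM)` in `Type` with `Q⟦μM⟧ ≅ B₁` has a connected sum `P` with `S² × S²`
  (closed, smooth, simply connected; the surgery along the standard framed circle of a chart,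
  `CircleNbhd.surgery_exists` + `StdChart.isConnectedSum_of_isOpenGluing`, Kirby 1989 Ch. X
  p. 55) and an orientation `μP` with `Q⟦μP⟧ ≅ B₁ ⊥ H` (the tree's
  `exists_addEquiv_intersectionForm_eq_of_isConnectedSum`, Kirby's Fig. 2a, with the sign of the
  orientation of `M` absorbed by reversing `μP`).
* `exists_smooth_intersectionForm_isEven_signature_zero` — for every `b` a closed smooth simply
  connected 4-manifold (`# b (S² × S²)`, from `S⁴`) whose intersection form is isometric to an
  even unimodular form of rank `2b` and signature `0`.
* `exists_smooth_intersectionForm_equivalent_of_isEven_of_signature_eq_zero`,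
  `exists_smooth_intersectionForm_equivalent_of_signature_eq_zero`,
  `exists_intersectionForm_equivalent_of_signature_eq_zero` — **Freedman's realisation theorem
  for forms of signature zero** (even: `b H`; odd: `j⟨1⟩ ⊕ j⟨-1⟩`), smooth and (literally the
  conclusion of the named fact) topological forms.

Sources: M. H. Freedman, F. Quinn, *Topology of 4-Manifolds* (1990), §10.1 (p. 161), §10.2A
(p. 162); R. Kirby, *The Topology of 4-Manifolds*, LNM 1374 (1989), Ch. II §1, Ch. X p. 55;
R. Gompf, A. Stipsicz, *4-Manifolds and Kirby Calculus* (1999), §1.2, §5.2; J.-P. Serre,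
*A Course in Arithmetic* (1973), Ch. V §1.3–§1.4, §2.2 Thms. 5–6; J. Milnor, D. Husemoller,
*Symmetric Bilinear Forms* (1973), §II.2–§II.5, §V.1.
-/

open scoped Manifold ContDiff
open LinearMap.BilinForm
open Module

noncomputable section

namespace Literature.Topology.FourManifolds

open Literature.AlgebraicTopology.SingularHomology

/-! ### Algebra: orthogonal decompositions given additively -/

/-- **An additive orthogonal decomposition is an isometry to the orthogonal sum.** If
`Θ : A × W₂ ≃+ C` satisfies `Q (Θ x) (Θ y) = Q_A x.1 y.1 + B₂ x.2 y.2` and `Q_A ≅ B₁`, then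
`Q ≅ B₁ ⊥ B₂` (Serre, *A Course in Arithmetic*, Ch. V §1.2: orthogonal direct sums; additive maps
of abelian groups are `ℤ`-linear for every `ℤ`-module structure, Mathlib's
`AddEquiv.toIntLinearEquiv`). The `Module ℤ` instances on `C`, `A` are arbitrary (the tree's
cohomology lattices carry `ModuleCat` instances); `W₁`, `W₂` carry the canonical ones.
[cite: Serre1973, Ch. V §1.2] -/
theorem equivalent_prod_of_addEquiv_of_equivalent {C A W₁ W₂ : Type*} [AddCommGroup C]
    [Module ℤ C] [AddCommGroup A] [Module ℤ A] [AddCommGroup W₁] [AddCommGroup W₂]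
    (Q : LinearMap.BilinForm ℤ C) (QA : LinearMap.BilinForm ℤ A) {B₁ : LinearMap.BilinForm ℤ W₁}
    (B₂ : LinearMap.BilinForm ℤ W₂) (Θ : (A × W₂) ≃+ C)
    (hΘ : ∀ x y, Q (Θ x) (Θ y) = QA x.1 y.1 + B₂ x.2 y.2) (hA : QA.Equivalent B₁) :
    Q.Equivalent (B₁.prod B₂) := by
  obtain ⟨e₁⟩ := hA
  -- the additive equivalence `C ≅ A × W₂ ≅ W₁ × W₂`
  let Ψ : C ≃+ W₁ × W₂ :=
    Θ.symm.trans (AddEquiv.prodCongr (e₁ : A ≃ₗ[ℤ] W₁).toAddEquiv (AddEquiv.refl W₂))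
  have hΨ : ∀ z : A × W₂, Ψ (Θ z) = (e₁ z.1, z.2) := by
    rintro ⟨a, w⟩
    change (AddEquiv.prodCongr (e₁ : A ≃ₗ[ℤ] W₁).toAddEquiv (AddEquiv.refl W₂)) (Θ.symm (Θ (a, w))) = _
    rw [AddEquiv.symm_apply_apply]
    rfl
  refine ⟨{ toLinearEquiv := Ψ.toIntLinearEquiv, map_app' := fun x y => ?_ }⟩
  obtain ⟨x', rfl⟩ := Θ.surjective x
  obtain ⟨y', rfl⟩ := Θ.surjective y
  change (B₁.prod B₂) (Ψ (Θ x')) (Ψ (Θ y')) = Q (Θ x') (Θ y')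
  rw [hΨ, hΨ, prod_apply, hΘ, e₁.map_app]

/-- **Sign bookkeeping `H ≅ -H`.** If `Θ : A × ℤ² ≃+ C` decomposes `Q` as `(-Q_A) ⊥ H`
(`H = (0 1; 1 0)` the hyperbolic plane), then precomposing `Θ` with `(v₀, v₁) ↦ (v₀, -v₁)` on the
`ℤ²` factor (the tree's `SphereProd.signTwist (-1)`, an isometry `H ≅ -H`) decomposes `-Q` as
`Q_A ⊥ H` (Serre, *A Course in Arithmetic*, Ch. V §1.4.2: `U ≅ -U`; used to absorb the
orientation sign of Kirby's Fig. 2a). [cite: Serre1973, Ch. V §1.4.2] -/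
theorem exists_addEquiv_neg_intersectionForm_of_neg {C A : Type*} [AddCommGroup C] [Module ℤ C]
    [AddCommGroup A] [Module ℤ A] (Q : LinearMap.BilinForm ℤ C) (QA : LinearMap.BilinForm ℤ A)
    (Θ : (A × (Fin 2 → ℤ)) ≃+ C)
    (hΘ : ∀ x y, Q (Θ x) (Θ y) = (-QA) x.1 y.1 + hyperbolicForm x.2 y.2) :
    ∃ Θ' : (A × (Fin 2 → ℤ)) ≃+ C,
      ∀ x y, (-Q) (Θ' x) (Θ' y) = QA x.1 y.1 + hyperbolicForm x.2 y.2 := by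
  let σ : (Fin 2 → ℤ) ≃+ (Fin 2 → ℤ) := (SphereProd.signTwist (-1) (by norm_num)).toAddEquiv
  have hσ : ∀ v w, hyperbolicForm (σ v) (σ w) = -hyperbolicForm v w := fun v w => by
    change hyperbolicForm (SphereProd.signTwist (-1) (by norm_num) v)
      (SphereProd.signTwist (-1) (by norm_num) w) = _
    rw [SphereProd.signTwist_apply, SphereProd.signTwist_apply, hyperbolicForm_apply,
      hyperbolicForm_apply]
    simp only [Matrix.cons_val_zero, Matrix.cons_val_one]
    ring
  refine ⟨(AddEquiv.prodCongr (AddEquiv.refl A) σ).trans Θ, ?_⟩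
  rintro ⟨a, v⟩ ⟨a', w⟩
  change (-Q) (Θ (a, σ v)) (Θ (a', σ w)) = QA a a' + hyperbolicForm v w
  rw [LinearMap.neg_apply, LinearMap.neg_apply, hΘ, hσ]
  change -((-(QA a)) a' + -hyperbolicForm v w) = QA a a' + hyperbolicForm v w
  rw [LinearMap.neg_apply]
  ring

/-! ### `X ↦ X # (S² × S²)` adds a hyperbolic plane -/

/-- **`Q_{M # (S² × S²)} ≅ Q_M ⊥ H`, existence form** (Freedman–Quinn 1990, §10.2A and §10.1
p. 161; Kirby 1989, Ch. II §1: "`S² × S²` has form `(0 1; 1 0)`" and Ch. X p. 55; Gompf–Stipsicz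
1999, §1.2, §5.2). For every closed smooth simply connected 4-manifold `M` in `Type` with a
`ℤ`-orientation `μM` and every lattice form `B₁ ≅ Q⟦μM⟧` there are a closed smooth simply
connected 4-manifold `P` which is a connected sum `M # (S² × S²)`
(`IsConnectedSum (𝓡 4) (𝓡 4) ((𝓡 2).prod (𝓡 2)) M (S² × S²) P`, the product keeping its product
model) and a `ℤ`-orientation `μP` of `P` with `Q⟦μP⟧ ≅ B₁ ⊥ H`. Proof: `P` is the surgery of `M`
along the standard framed circle of a chart (`StdChart.exists_mem_source`,
`CircleNbhd.surgery_exists`), a connected sum with `S² × S²` by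
`StdChart.isConnectedSum_of_isOpenGluing` (Kirby 1989, Ch. X p. 55), simply connected by van
Kampen (`IsConnectedSum.simplyConnectedSpace_holds`); its form is `Q⟦±μM⟧ ⊥ H` through an additive
bijection (`exists_addEquiv_intersectionForm_eq_of_isConnectedSum`, Kirby's Fig. 2a), and the sign
is absorbed by reversing `μP` (`exists_addEquiv_neg_intersectionForm_of_neg`, `[P]_{-μ} = -[P]_μ`).
[cite: FreedmanQuinnPMS1990, §10.2A (p. 162) and §10.1 (p. 161)] [cite: Kirby1989, Ch. II §1 and Ch. X p. 55]
[cite: GompfStipsicz1999, §1.2 and §5.2] -/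
theorem exists_isConnectedSum_sphereProd_intersectionForm_equivalent_prod_hyperbolicForm
    (M : Type) [TopologicalSpace M] [T2Space M] [SecondCountableTopology M]
    [ChartedSpace (EuclideanSpace ℝ (Fin 4)) M] [IsManifold (𝓡 4) ∞ M] [CompactSpace M]
    [SimplyConnectedSpace M] (μM : HomologicalOrientation ℤ M 4) {W₁ : Type*} [AddCommGroup W₁]
    {B₁ : LinearMap.BilinForm ℤ W₁}
    (h₁ : (intersectionForm two_add_two_eq_four μM).Equivalent B₁) :
    ∃ (P : Type) (_ : TopologicalSpace P) (_ : T2Space P) (_ : SecondCountableTopology P)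
      (_ : ChartedSpace (EuclideanSpace ℝ (Fin 4)) P) (_ : IsManifold (𝓡 4) ∞ P)
      (_ : CompactSpace P) (_ : SimplyConnectedSpace P) (μP : HomologicalOrientation ℤ P 4),
      IsConnectedSum (𝓡 4) (𝓡 4) ((𝓡 2).prod (𝓡 2)) M
          ((Metric.sphere (0 : EuclideanSpace ℝ (Fin (2 + 1))) 1) ×
            (Metric.sphere (0 : EuclideanSpace ℝ (Fin (2 + 1))) 1)) P ∧
        (intersectionForm two_add_two_eq_four μP).Equivalent (B₁.prod hyperbolicForm) := by
  -- surgery along the standard framed circle of a chart: `P = M # (S² × S²)`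
  obtain ⟨x⟩ : Nonempty M := inferInstance
  obtain ⟨C, -, -⟩ := StdChart.exists_mem_source x
  obtain ⟨P, _, _, _, _, _, _, hglue⟩ := CircleNbhd.surgery_exists C.nbhd
  have hsum := C.isConnectedSum_of_isOpenGluing hglue
  haveI : SimplyConnectedSpace ((Metric.sphere (0 : EuclideanSpace ℝ (Fin (2 + 1))) 1) ×
      (Metric.sphere (0 : EuclideanSpace ℝ (Fin (2 + 1))) 1)) :=
    SphereProd.simplyConnectedSpace le_rfl
  haveI : SimplyConnectedSpace P :=
    IsConnectedSum.simplyConnectedSpace_holds (by rw [finrank_euclideanSpace_fin]; norm_num) hsum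
  obtain ⟨μP⟩ : Nonempty (HomologicalOrientation ℤ P 4) :=
    isOrientableOver_int_of_simplyConnectedSpace_holds P (n := 4)
  -- the form of `P` is `Q⟦±μM⟧ ⊥ H`
  obtain ⟨ν', hν', Θ, hΘ⟩ := exists_addEquiv_intersectionForm_eq_of_isConnectedSum M μM P hsum μP
  rcases hν' with rfl | rfl
  · exact ⟨P, inferInstance, inferInstance, inferInstance, inferInstance, inferInstance,
      inferInstance, inferInstance, μP, hsum,
      equivalent_prod_of_addEquiv_of_equivalent _ _ hyperbolicForm Θ hΘ h₁⟩
  · -- `ν' = -μM`: reverse the orientation of `P` and twist the hyperbolic plane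
    have hneg : ∀ x y, intersectionForm two_add_two_eq_four μP (Θ x) (Θ y) =
        (-intersectionForm two_add_two_eq_four μM) x.1 y.1 + hyperbolicForm x.2 y.2 := fun x y => by
      rw [hΘ, intersectionForm_neg (HomologicalOrientation.fundamentalClass_neg_holds ℤ M 4)]
    obtain ⟨Θ', hΘ'⟩ := exists_addEquiv_neg_intersectionForm_of_neg _ _ Θ hneg
    refine ⟨P, inferInstance, inferInstance, inferInstance, inferInstance, inferInstance,
      inferInstance, inferInstance, -μP, hsum,
      equivalent_prod_of_addEquiv_of_equivalent _ _ hyperbolicForm Θ' (fun x y => ?_) h₁⟩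
    rw [intersectionForm_neg (HomologicalOrientation.fundamentalClass_neg_holds ℤ P 4)]
    exact hΘ' x y

/-! ### `# b (S² × S²)`: even forms of rank `2b` and signature `0` -/

/-- **The manifolds `# b (S² × S²)`** (Freedman–Quinn 1990, §10.1 p. 161: "`S⁴` and `S² × S²`
have even forms"; Kirby 1989, Ch. II §1: `S² × S²` has form `(0 1; 1 0)`, the form of a connected
sum is the orthogonal sum): for every `b` there is a closed smooth simply connected 4-manifold
with a `ℤ`-orientation whose intersection form is isometric to a symmetric unimodular **even**
lattice form of rank `2b` and **signature `0`** (namely `H ⊥ ⋯ ⊥ H`). Induction on `b`: `S⁴`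
(zero lattice), then `X ↦ X # (S² × S²)`
(`exists_isConnectedSum_sphereProd_intersectionForm_equivalent_prod_hyperbolicForm`), the
invariants of `B ⊥ H` being `τ(B ⊥ H) = τ(B) + τ(H) = τ(B)` (`signature_prod`,
`signature_hyperbolicForm_holds`), `rank + 2`, even and unimodular iff `B` is
(`isEven_prod_iff`, `isUnimodular_prod_iff`; Serre Ch. V §1.3.7, §1.4.2).
[cite: FreedmanQuinnPMS1990, §10.1 (p. 161) and §10.2A] [cite: Kirby1989, Ch. II §1, Examples]
[cite: Serre1973, Ch. V §1.3.7 and §1.4.2] -/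
theorem exists_smooth_intersectionForm_isEven_signature_zero : ∀ b : ℕ,
    ∃ (M : Type) (_ : TopologicalSpace M) (_ : T2Space M) (_ : SecondCountableTopology M)
      (_ : ChartedSpace (EuclideanSpace ℝ (Fin 4)) M) (_ : IsManifold (𝓡 4) ∞ M)
      (_ : CompactSpace M) (_ : SimplyConnectedSpace M) (μ : HomologicalOrientation ℤ M 4)
      (W : Type) (_ : AddCommGroup W) (_ : Module.Finite ℤ W) (_ : Module.Free ℤ W)
      (B : LinearMap.BilinForm ℤ W),
      (intersectionForm two_add_two_eq_four μ).Equivalent B ∧ B.IsSymm ∧ B.IsUnimodular ∧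
        B.IsEven ∧ B.signature = 0 ∧ Module.finrank ℤ W = 2 * b
  | 0 => by
    -- `S⁴` and the zero lattice `ℤ⁰`
    obtain ⟨M, _, _, _, _, _, _, _, μ, hμ⟩ :=
      exists_smooth_intersectionForm_equivalent_toBilin'_diagonal 0 Fin.elim0 fun i => i.elim0
    have hB : (0 : LinearMap.BilinForm ℤ (Fin 0 → ℤ)).IsUnimodular :=
      isUnimodular_of_equivalent
        (hμ.trans (bilinFormInt_equivalent_of_subsingleton _ (0 : LinearMap.BilinForm ℤ (Fin 0 → ℤ))))
        (isUnimodular_intersectionForm_holds two_add_two_eq_four μ)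
    refine ⟨M, inferInstance, inferInstance, inferInstance, inferInstance, inferInstance,
      inferInstance, inferInstance, μ, Fin 0 → ℤ, inferInstance, inferInstance, inferInstance, 0,
      hμ.trans (bilinFormInt_equivalent_of_subsingleton _ _), ⟨fun x y => by simp⟩, hB,
      fun x => by simp, ?_, by simp⟩
    have h := abs_signature_le_finrank (0 : LinearMap.BilinForm ℤ (Fin 0 → ℤ))
    rw [Module.finrank_fin_fun] at h
    simpa using h
  | b + 1 => by
    obtain ⟨M, _, _, _, _, _, _, _, μ, W, _, _, _, B, hQB, hs, hu, he, hσ, hr⟩ :=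
      exists_smooth_intersectionForm_isEven_signature_zero b
    obtain ⟨P, _, _, _, _, _, _, _, μP, -, hP⟩ :=
      exists_isConnectedSum_sphereProd_intersectionForm_equivalent_prod_hyperbolicForm M μ hQB
    refine ⟨P, inferInstance, inferInstance, inferInstance, inferInstance, inferInstance,
      inferInstance, inferInstance, μP, W × (Fin 2 → ℤ), inferInstance, inferInstance,
      inferInstance, B.prod hyperbolicForm, hP, hs.prod isSymm_hyperbolicForm,
      isUnimodular_prod_iff.2 ⟨hu, isUnimodular_hyperbolicForm_holds⟩,
      isEven_prod_iff.2 ⟨he, isEven_hyperbolicForm⟩, ?_, ?_⟩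
    · rw [signature_prod B hyperbolicForm hs isSymm_hyperbolicForm, hσ, zero_add]
      exact signature_hyperbolicForm_holds
    · rw [Module.finrank_prod, hr, Module.finrank_fin_fun]
      ring

/-! ### Freedman's realisation theorem for forms of signature zero -/

/-- **Freedman's realisation theorem for even forms of signature zero, smooth version.** Every
symmetric unimodular *even* form of signature `0` on a finitely generated free abelian group is
the intersection form of a closed *smooth* simply connected 4-manifold, namely of
`# b (S² × S²)`, `2b = rank`: an even form is `≠ 0` only in positive rank, where signature `0`
makes it indefinite (`|σ| < rank`, `isIndefinite_iff_abs_signature_lt_finrank`, Freedman–Quinn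
§10.2A), and two even indefinite unimodular forms with the same rank and signature are isometric
(Serre, *A Course in Arithmetic*, Ch. V §2.2 Thm. 5/6 — the tree's
`equivalent_of_isEven_of_isIndefinite` with the proved Thm. 3 `exists_isotropic_of_isIndefinite_holds`);
the rank is even because `rank = b⁺ + b⁻` and `0 = σ = b⁺ - b⁻`
(`sigPos_add_sigNeg_eq_finrank_of_isSymm`). Freedman–Quinn 1990, §10.1 Theorem (1) and p. 161
("`S⁴` and `S² × S²` have even forms, so are uniquely determined by their forms").
[cite: FreedmanQuinnPMS1990, §10.1 Theorem (1) (p. 161) and §10.2A] [cite: Serre1973, Ch. V §2.2 Thms 5, 6] -/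
theorem exists_smooth_intersectionForm_equivalent_of_isEven_of_signature_eq_zero {V : Type}
    [AddCommGroup V] [Module ℤ V] [Module.Finite ℤ V] [Module.Free ℤ V]
    (Q : LinearMap.BilinForm ℤ V) (hs : Q.IsSymm) (hu : Q.IsUnimodular) (he : Q.IsEven)
    (hσ : Q.signature = 0) :
    ∃ (M : Type) (_ : TopologicalSpace M) (_ : T2Space M) (_ : SecondCountableTopology M)
      (_ : ChartedSpace (EuclideanSpace ℝ (Fin 4)) M) (_ : IsManifold (𝓡 4) ∞ M)
      (_ : CompactSpace M) (_ : SimplyConnectedSpace M) (μ : HomologicalOrientation ℤ M 4),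
      (intersectionForm two_add_two_eq_four μ).Equivalent Q := by
  have hV := Subsingleton.elim ‹Module ℤ V› (AddCommGroup.toIntModule V)
  subst hV
  -- `rank = 2 b⁺`
  have hpn := sigPos_add_sigNeg_eq_finrank_of_isSymm Q hs hu.separatingLeft
  have hb : finrank ℤ V = 2 * sigPos Q.toQuadraticMap := by
    unfold signature at hσ
    omega
  obtain ⟨M, _, _, _, _, _, _, _, μ, W, _, _, _, B, hQB, hsB, huB, heB, hσB, hrB⟩ :=
    exists_smooth_intersectionForm_isEven_signature_zero (sigPos Q.toQuadraticMap)
  refine ⟨M, inferInstance, inferInstance, inferInstance, inferInstance, inferInstance,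
    inferInstance, inferInstance, μ, hQB.trans ?_⟩
  -- `B ≅ Q`: both zero, or both even indefinite unimodular of the same rank and signature
  by_cases h0 : finrank ℤ V = 0
  · haveI : Subsingleton V := Module.finrank_zero_iff.1 h0
    haveI : Subsingleton W := Module.finrank_zero_iff.1 (by rw [hrB, ← hb, h0])
    exact bilinFormInt_equivalent_of_subsingleton B Q
  · have hiQ : Q.IsIndefinite := by
      rw [isIndefinite_iff_abs_signature_lt_finrank hs hu.separatingLeft, hσ, abs_zero]
      exact_mod_cast Nat.pos_of_ne_zero h0
    have hiB : B.IsIndefinite := by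
      rw [isIndefinite_iff_abs_signature_lt_finrank hsB huB.separatingLeft, hσB, abs_zero, hrB,
        ← hb]
      exact_mod_cast Nat.pos_of_ne_zero h0
    exact equivalent_of_isEven_of_isIndefinite exists_isotropic_of_isIndefinite_holds
      exists_isotropic_of_isIndefinite_holds hsB huB heB hiB hs hu he hiQ (by rw [hrB, hb])
      (by rw [hσB, hσ])

/-- **Freedman's realisation theorem for forms of signature zero, smooth version.** Every
symmetric unimodular form of signature `0` on a finitely generated free abelian group is the
intersection form of a closed *smooth* simply connected 4-manifold: an even one is that of
`# b (S² × S²)` (`exists_smooth_intersectionForm_equivalent_of_isEven_of_signature_eq_zero`); an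
odd one lives in positive rank, is indefinite (`|σ| = 0 < rank`) and hence `j⟨1⟩ ⊕ j⟨-1⟩`, the
form of `j ℂℙ² # j (-ℂℙ²)` (`exists_smooth_intersectionForm_equivalent_of_isOdd_of_isIndefinite`,
Serre Ch. V Thm. 4; Freedman–Quinn 1990, proof of 10.1 p. 168).
[cite: FreedmanQuinnPMS1990, §10.1 Theorem (1) (p. 161); proof of 10.1 (p. 168)] [cite: Serre1973, Ch. V §2.2 Thms 4–6] -/
theorem exists_smooth_intersectionForm_equivalent_of_signature_eq_zero {V : Type}
    [AddCommGroup V] [Module ℤ V] [Module.Finite ℤ V] [Module.Free ℤ V]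
    (Q : LinearMap.BilinForm ℤ V) (hs : Q.IsSymm) (hu : Q.IsUnimodular) (hσ : Q.signature = 0) :
    ∃ (M : Type) (_ : TopologicalSpace M) (_ : T2Space M) (_ : SecondCountableTopology M)
      (_ : ChartedSpace (EuclideanSpace ℝ (Fin 4)) M) (_ : IsManifold (𝓡 4) ∞ M)
      (_ : CompactSpace M) (_ : SimplyConnectedSpace M) (μ : HomologicalOrientation ℤ M 4),
      (intersectionForm two_add_two_eq_four μ).Equivalent Q := by
  by_cases he : Q.IsEven
  · exact exists_smooth_intersectionForm_equivalent_of_isEven_of_signature_eq_zero Q hs hu he hσ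
  · have hV := Subsingleton.elim ‹Module ℤ V› (AddCommGroup.toIntModule V)
    subst hV
    -- an odd form has positive rank, so signature `0` makes it indefinite
    have h0 : finrank ℤ V ≠ 0 := fun h0 => by
      haveI : Subsingleton V := Module.finrank_zero_iff.1 h0
      exact he fun x => by rw [Subsingleton.elim x 0]; simp
    have hi : Q.IsIndefinite := by
      rw [isIndefinite_iff_abs_signature_lt_finrank hs hu.separatingLeft, hσ, abs_zero]
      exact_mod_cast Nat.pos_of_ne_zero h0
    exact exists_smooth_intersectionForm_equivalent_of_isOdd_of_isIndefinite Q hs hu he hi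

/-- **Freedman's realisation theorem for forms of signature zero** (the signature-zero case of
`Literature.Topology.FourManifolds.exists_intersectionForm_equivalent`, with literally its
conclusion; Freedman–Quinn 1990, §10.1 Theorem (1), p. 161): every symmetric unimodular form of
signature `0` on a finitely generated free abelian group is the intersection form of a closed
simply connected topological 4-manifold (indeed of `# b (S² × S²)` or `j ℂℙ² # j (-ℂℙ²)`).
[cite: FreedmanQuinnPMS1990, §10.1 Theorem (1) (p. 161)] -/
theorem exists_intersectionForm_equivalent_of_signature_eq_zero {V : Type}
    [AddCommGroup V] [Module ℤ V] [Module.Finite ℤ V] [Module.Free ℤ V]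
    (Q : LinearMap.BilinForm ℤ V) (hs : Q.IsSymm) (hu : Q.IsUnimodular) (hσ : Q.signature = 0) :
    ∃ (M : Type) (_ : TopologicalSpace M) (_ : T2Space M) (_ : SecondCountableTopology M)
      (_ : ChartedSpace (EuclideanSpace ℝ (Fin 4)) M) (_ : CompactSpace M)
      (_ : SimplyConnectedSpace M) (μ : HomologicalOrientation ℤ M 4),
      (intersectionForm two_add_two_eq_four μ).Equivalent Q := by
  obtain ⟨M, _, _, _, _, _, _, _, μ, hμ⟩ :=
    exists_smooth_intersectionForm_equivalent_of_signature_eq_zero Q hs hu hσ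
  exact ⟨M, inferInstance, inferInstance, inferInstance, inferInstance, inferInstance,
    inferInstance, μ, hμ⟩

end Literature.Topology.FourManifolds

end
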